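import Summits.AtomisticToContinuum.FouriersLaw.Theorems.BondHeatUncertaintyBoundedResponseBathHeatCumulantB
import HarnessLib

/-!
# Bounded response, bath heat: WickDefect / CumulantChannels (lens-1 NODE 108) — part 3 of 5 (sequel of `…BondHeatUncertaintyBoundedResponseBathHeatCumulantB`)

Split for the 400-line cap by the landing lane (hand-2 g39); the module docstring of part 1 (`…BondHeatUncertaintyBoundedResponseBathHeatCumulantA`) describes the whole node.  Same namespace; all FQNs unchanged.
0 sorry; standard axioms.
-/

noncomputable section
open MeasureTheory ProbabilityTheory Filter Topology Set Function
open scoped NNReal ENNReal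
open Literature.MathematicalPhysics.KineticTheory.HeatConduction
open Literature.MathematicalPhysics.KineticTheory OscillatorChain
open Literature.Probability.Process
open Summit.AtomisticToContinuum.FouriersLaw.Theorems.SubdiffusiveBondHeat
open Summit.AtomisticToContinuum.FouriersLaw.Theorems.SubdiffusiveBondHeat.EscapeGrading
open Summit.AtomisticToContinuum.FouriersLaw.Theorems.IncoherentChannel.Negative.KernelMoments
  (integrable_sq_momentum_transitionKernel harmonic_kernel_momentum harmonic_kernel_momentum_sq)
open Summit.AtomisticToContinuum.FouriersLaw.Theorems.IncoherentChannel.Negative.HarmonicFlow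
  (harmonic_chainFlow_zero_noise_linear integral_gibbsMeasure_eq_zero_of_odd)
open Summit.AtomisticToContinuum.FouriersLaw.Theorems.IncoherentChannel.Negative.GibbsStein
  (integrable_gibbsMeasure_of_growth pow_le_one_add_sq_sq gibbs_sq_momentum gibbs_momentum_mul_clm gibbs_sq_momentum_mul_clm_sq)
open Summit.AtomisticToContinuum.FouriersLaw.Cruxes.SuperadditiveResistance.FloatingProbeBypassLaplacian
  (integral_flip_gibbsMeasure integrable_flip_gibbsMeasure)

namespace Summit.AtomisticToContinuum.FouriersLaw.Theorems.BoundedResponse.HeatSpreading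

open Summit.AtomisticToContinuum.FouriersLaw.Theses.BondHeatUncertainty (BoundedResponse SubdiffusiveBondHeat)
open Summit.AtomisticToContinuum.FouriersLaw.Theorems.BoundedResponse.TransientBand
  (escapeKernel escapeTransient warburgDip TransientFloor WarburgDipFloor transientFloor_one_of_warburgDipFloor)

/-- ★ **HARMONIC WICK CALIBRATION (Isserlis), PROVED**: for the pinned HARMONIC chain (`lam = β = 0`, `ω₂ > 0`, `γ ≥ 0`, `T > 0`, `N ≥ 1`) and
every `t`, `K_N(t) = 2·c_N(t)²` AND `CP_N(t) = 2·c_N(t)²`: the boundary kinetic kernel IS twice the square of the linear functional `c_N`, and so is the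
common-past channel.  Same-site twin of `IncoherentChannel.Negative.HarmonicWick.harmonic_wick` (there: the end-to-end kernel `C_N = 2r_N²`); ingredients:
superposition of the constructed flow (`M_t` linear), the flow-shifted harmonic kernel, reflection symmetry, and the Stein/Wick identities of the Gibbs
measure in the `p₀` direction (`gibbs_momentum_mul_clm`, `gibbs_sq_momentum_mul_clm_sq`).  [cite: RiederLebowitzLieb1967] -/
theorem bathKinCorr_commonPast_harmonic_eq {ω₂ γ T : ℝ} (hω : 0 < ω₂) (hγ : 0 ≤ γ) (hT : 0 < T) {N : ℕ} (hN : 0 < N) (t : ℝ) :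
    bathKinCorr ω₂ 0 0 γ T N t = 2 * (bathMomCorr ω₂ 0 0 γ T N t) ^ 2 ∧
      bathCommonPast ω₂ 0 0 γ T N t = 2 * (bathMomCorr ω₂ 0 0 γ T N t) ^ 2 := by
  obtain ⟨n, rfl⟩ : ∃ n, N = n + 1 := ⟨N - 1, by omega⟩
  have hn : 0 < n + 1 := Nat.succ_pos n
  set P := pinnedChain ω₂ 0 0 γ with hP
  set τ : ℝ≥0 := t.toNNReal with hτ
  set μ := P.gibbsMeasure (n + 1) T with hμ
  haveI : IsProbabilityMeasure μ := pinnedChain_isProbabilityMeasure_gibbsMeasure hω le_rfl le_rfl γ (n + 1) hT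
  -- the deterministic flow is linear; gL = p₀ ∘ M_τ as a continuous linear functional
  obtain ⟨M, hM⟩ := harmonic_chainFlow_zero_noise_linear hω hγ (n + 1) (τ : ℝ)
  set gL : PhaseSpace (n + 1) →L[ℝ] ℝ :=
    LinearMap.toContinuousLinearMap (((LinearMap.proj (0 : Fin (n + 1))).comp (LinearMap.snd ℝ _ _)).comp M) with hgL
  have hg : ∀ x, gL x = (M x).2 0 := fun x => rfl
  set G := ‖gL‖ with hG
  have hgb : ∀ x, |gL x| ≤ G * ‖x‖ := fun x => by
    have := gL.le_opNorm x; rwa [Real.norm_eq_abs] at this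
  -- kernel moments at rest, and the kernel action on `p₀`, `p₀²`
  set m : ℝ := ∫ y, y.2 (0 : Fin (n + 1)) ∂(P.transitionKernel (n + 1) T T τ 0) with hm
  set w : ℝ := ∫ y, y.2 (0 : Fin (n + 1)) ^ 2 ∂(P.transitionKernel (n + 1) T T τ 0) with hw
  have hK1 : ∀ z : PhaseSpace (n + 1), ∫ y, y.2 0 ∂(P.transitionKernel (n + 1) T T τ z) = gL z + m := by
    intro z
    rw [harmonic_kernel_momentum hω hγ hn hT τ z 0, hM z, hg]
  have hK2 : ∀ z : PhaseSpace (n + 1), ∫ y, y.2 0 ^ 2 ∂(P.transitionKernel (n + 1) T T τ z) = gL z ^ 2 + 2 * gL z * m + w := by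
    intro z
    rw [harmonic_kernel_momentum_sq hω hγ hn hT τ z 0, hM z, hg]
  have hK2c : ∀ z : PhaseSpace (n + 1), ∫ y, (y.2 0 ^ 2 - T) ∂(P.transitionKernel (n + 1) T T τ z) =
      gL z ^ 2 + 2 * gL z * m + (w - T) := by
    intro z
    rw [hP, PhononMeanFreePath.kinAutocov_kinFcast_eq hω hT le_rfl le_rfl hγ n τ z, ← hP, hK2 z]
    ring
  have hgc : Continuous fun x : PhaseSpace (n + 1) => gL x := gL.continuous
  have hpc : Continuous fun x : PhaseSpace (n + 1) => x.2 (0 : Fin (n + 1)) := by fun_prop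
  -- integrability under μ (growth bounds)
  have hI_p : Integrable (fun x : PhaseSpace (n + 1) => x.2 0) μ := by
    refine integrable_gibbsMeasure_of_growth hω le_rfl le_rfl hT hpc (A := 1) fun x => ?_
    have h1 := OscillatorChain.abs_snd_apply_le_norm x 0
    have h2 := (pow_le_one_add_sq_sq (norm_nonneg x)).1
    linarith
  have hI_g : Integrable (fun x : PhaseSpace (n + 1) => gL x) μ := by
    refine integrable_gibbsMeasure_of_growth hω le_rfl le_rfl hT hgc (A := G) fun x => ?_
    have h2 := (pow_le_one_add_sq_sq (norm_nonneg x)).1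
    calc |gL x| ≤ G * ‖x‖ := hgb x
      _ ≤ G * (1 + ‖x‖ ^ 2) ^ 2 := by nlinarith [norm_nonneg gL]
  have hI_pg : Integrable (fun x : PhaseSpace (n + 1) => x.2 0 * gL x) μ := by
    refine integrable_gibbsMeasure_of_growth hω le_rfl le_rfl hT (hpc.mul hgc) (A := G) fun x => ?_
    have h1 := OscillatorChain.abs_snd_apply_le_norm x 0
    have h4 := (pow_le_one_add_sq_sq (norm_nonneg x)).2.1
    rw [abs_mul]
    calc |x.2 0| * |gL x| ≤ ‖x‖ * (G * ‖x‖) := mul_le_mul h1 (hgb x) (abs_nonneg _) (norm_nonneg _)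
      _ = G * ‖x‖ ^ 2 := by ring
      _ ≤ G * (1 + ‖x‖ ^ 2) ^ 2 := by nlinarith [norm_nonneg gL]
  have hI_pp : Integrable (fun x : PhaseSpace (n + 1) => x.2 0 ^ 2) μ := by
    refine integrable_gibbsMeasure_of_growth hω le_rfl le_rfl hT (hpc.pow 2) (A := 1) fun x => ?_
    have h1 := OscillatorChain.abs_snd_apply_le_norm x 0
    have h4 := (pow_le_one_add_sq_sq (norm_nonneg x)).2.1
    rw [abs_pow]
    calc |x.2 0| ^ 2 ≤ ‖x‖ ^ 2 := pow_le_pow_left₀ (abs_nonneg _) h1 2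
      _ ≤ 1 * (1 + ‖x‖ ^ 2) ^ 2 := by linarith
  have hI_gg : Integrable (fun x : PhaseSpace (n + 1) => gL x ^ 2) μ := by
    refine integrable_gibbsMeasure_of_growth hω le_rfl le_rfl hT (hgc.pow 2) (A := G ^ 2) fun x => ?_
    rw [abs_pow]
    have h4 := (pow_le_one_add_sq_sq (norm_nonneg x)).2.1
    calc |gL x| ^ 2 ≤ (G * ‖x‖) ^ 2 := pow_le_pow_left₀ (abs_nonneg _) (hgb x) 2
      _ = G ^ 2 * ‖x‖ ^ 2 := by ring
      _ ≤ G ^ 2 * (1 + ‖x‖ ^ 2) ^ 2 := by nlinarith [sq_nonneg G]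
  have hI_ppg : Integrable (fun x : PhaseSpace (n + 1) => x.2 0 ^ 2 * gL x) μ := by
    refine integrable_gibbsMeasure_of_growth hω le_rfl le_rfl hT ((hpc.pow 2).mul hgc) (A := G) fun x => ?_
    have h1 := OscillatorChain.abs_snd_apply_le_norm x 0
    have h5 := (pow_le_one_add_sq_sq (norm_nonneg x)).2.2.1
    rw [abs_mul, abs_pow]
    have e1 : |x.2 0| ^ 2 ≤ ‖x‖ ^ 2 := pow_le_pow_left₀ (abs_nonneg _) h1 2
    calc |x.2 0| ^ 2 * |gL x| ≤ ‖x‖ ^ 2 * (G * ‖x‖) := mul_le_mul e1 (hgb x) (abs_nonneg _) (by positivity)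
      _ = G * ‖x‖ ^ 3 := by ring
      _ ≤ G * (1 + ‖x‖ ^ 2) ^ 2 := by nlinarith [norm_nonneg gL]
  have hI_ppgg : Integrable (fun x : PhaseSpace (n + 1) => x.2 0 ^ 2 * gL x ^ 2) μ := by
    refine integrable_gibbsMeasure_of_growth hω le_rfl le_rfl hT ((hpc.pow 2).mul (hgc.pow 2)) (A := G ^ 2) fun x => ?_
    have h1 := OscillatorChain.abs_snd_apply_le_norm x 0
    have h6 := (pow_le_one_add_sq_sq (norm_nonneg x)).2.2.2
    rw [abs_mul, abs_pow, abs_pow]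
    have e1 : |x.2 0| ^ 2 ≤ ‖x‖ ^ 2 := pow_le_pow_left₀ (abs_nonneg _) h1 2
    have e2 : |gL x| ^ 2 ≤ (G * ‖x‖) ^ 2 := pow_le_pow_left₀ (abs_nonneg _) (hgb x) 2
    calc |x.2 0| ^ 2 * |gL x| ^ 2 ≤ ‖x‖ ^ 2 * (G * ‖x‖) ^ 2 := mul_le_mul e1 e2 (by positivity) (by positivity)
      _ = G ^ 2 * ‖x‖ ^ 4 := by ring
      _ ≤ G ^ 2 * (1 + ‖x‖ ^ 2) ^ 2 := by nlinarith [sq_nonneg G]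
  -- odd moments vanish (reflection symmetry)
  have hodd_p : ∫ x, x.2 (0 : Fin (n + 1)) ∂μ = 0 :=
    integral_gibbsMeasure_eq_zero_of_odd (n + 1) T (fun x => by simp)
  have hodd_g : ∫ x, gL x ∂μ = 0 :=
    integral_gibbsMeasure_eq_zero_of_odd (n + 1) T (fun x => by simp)
  have hodd_ppg : ∫ x, x.2 (0 : Fin (n + 1)) ^ 2 * gL x ∂μ = 0 :=
    integral_gibbsMeasure_eq_zero_of_odd (n + 1) T (fun x => by simp)
  -- Gaussian facts of the Gibbs measure
  have hp2 : ∫ x, x.2 (0 : Fin (n + 1)) ^ 2 ∂μ = T := gibbs_sq_momentum hω le_rfl le_rfl hT 0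
  have h4 : ∫ x, x.2 0 ^ 2 * gL x ^ 2 ∂μ = T * ∫ x, gL x ^ 2 ∂μ + 2 * (∫ x, x.2 0 * gL x ∂μ) ^ 2 :=
    gibbs_sq_momentum_mul_clm_sq hω le_rfl le_rfl hT 0 gL
  -- the three functionals at lam = β = 0
  have ec : bathMomCorr ω₂ 0 0 γ T (n + 1) t = ∫ x, x.2 0 * gL x ∂μ := by
    unfold bathMomCorr
    rw [dif_pos hn]
    change ∫ z, z.2 0 * (∫ y, y.2 0 ∂(P.transitionKernel (n + 1) T T τ z)) ∂μ = _
    simp_rw [hK1]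
    have : (fun z : PhaseSpace (n + 1) => z.2 0 * (gL z + m)) = fun z => z.2 0 * gL z + m * z.2 0 :=
      funext fun z => by ring
    rw [this, integral_add hI_pg (hI_p.const_mul m), integral_const_mul, hodd_p, mul_zero, add_zero]
  have eK : bathKinCorr ω₂ 0 0 γ T (n + 1) t = ∫ x, x.2 0 ^ 2 * gL x ^ 2 ∂μ - T * ∫ x, gL x ^ 2 ∂μ := by
    unfold bathKinCorr
    rw [dif_pos hn]
    change ∫ z, (z.2 0 ^ 2 - T) * (∫ y, (y.2 0 ^ 2 - T) ∂(P.transitionKernel (n + 1) T T τ z)) ∂μ = _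
    simp_rw [hK2c]
    have e1 : (fun z : PhaseSpace (n + 1) => (z.2 0 ^ 2 - T) * (gL z ^ 2 + 2 * gL z * m + (w - T))) =
        fun z => ((z.2 0 ^ 2 * gL z ^ 2 + 2 * m * (z.2 0 ^ 2 * gL z)) + (w - T) * z.2 0 ^ 2) -
          ((T * gL z ^ 2 + 2 * m * T * gL z) + (w - T) * T) := funext fun z => by ring
    have hI1 : Integrable (fun z : PhaseSpace (n + 1) => z.2 0 ^ 2 * gL z ^ 2 + 2 * m * (z.2 0 ^ 2 * gL z)) μ :=
      hI_ppgg.add (hI_ppg.const_mul _)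
    have hI2 : Integrable (fun z : PhaseSpace (n + 1) => (w - T) * z.2 0 ^ 2) μ := hI_pp.const_mul _
    have hI3 : Integrable (fun z : PhaseSpace (n + 1) => 2 * m * (z.2 0 ^ 2 * gL z)) μ := hI_ppg.const_mul _
    have hI4 : Integrable (fun z : PhaseSpace (n + 1) => T * gL z ^ 2 + 2 * m * T * gL z) μ :=
      (hI_gg.const_mul T).add (hI_g.const_mul _)
    have hI5 : Integrable (fun z : PhaseSpace (n + 1) => 2 * m * T * gL z) μ := hI_g.const_mul _
    have hA : Integrable (fun z : PhaseSpace (n + 1) =>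
        (z.2 0 ^ 2 * gL z ^ 2 + 2 * m * (z.2 0 ^ 2 * gL z)) + (w - T) * z.2 0 ^ 2) μ := hI1.add hI2
    have hB : Integrable (fun z : PhaseSpace (n + 1) => (T * gL z ^ 2 + 2 * m * T * gL z) + (w - T) * T) μ :=
      hI4.add (integrable_const _)
    rw [e1, integral_sub hA hB, integral_add hI1 hI2, integral_add hI_ppgg hI3,
      integral_add hI4 (integrable_const _), integral_add (hI_gg.const_mul T) hI5, integral_const_mul, integral_const_mul,
      integral_const_mul, integral_const_mul, integral_const, probReal_univ, one_smul, hodd_ppg, hodd_g, hp2]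
    ring
  have eP : bathCommonPast ω₂ 0 0 γ T (n + 1) t = ∫ x, x.2 0 ^ 2 * gL x ^ 2 ∂μ - T * ∫ x, gL x ^ 2 ∂μ := by
    unfold bathCommonPast
    rw [dif_pos hn]
    change ∫ z, (z.2 0 ^ 2 - T) * (∫ y, y.2 0 ∂(P.transitionKernel (n + 1) T T τ z)) ^ 2 ∂μ = _
    simp_rw [hK1]
    have e1 : (fun z : PhaseSpace (n + 1) => (z.2 0 ^ 2 - T) * (gL z + m) ^ 2) =
        fun z => ((z.2 0 ^ 2 * gL z ^ 2 + 2 * m * (z.2 0 ^ 2 * gL z)) + m ^ 2 * z.2 0 ^ 2) -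
          ((T * gL z ^ 2 + 2 * m * T * gL z) + m ^ 2 * T) := funext fun z => by ring
    have hI1 : Integrable (fun z : PhaseSpace (n + 1) => z.2 0 ^ 2 * gL z ^ 2 + 2 * m * (z.2 0 ^ 2 * gL z)) μ :=
      hI_ppgg.add (hI_ppg.const_mul _)
    have hI2 : Integrable (fun z : PhaseSpace (n + 1) => m ^ 2 * z.2 0 ^ 2) μ := hI_pp.const_mul _
    have hI3 : Integrable (fun z : PhaseSpace (n + 1) => 2 * m * (z.2 0 ^ 2 * gL z)) μ := hI_ppg.const_mul _
    have hI4 : Integrable (fun z : PhaseSpace (n + 1) => T * gL z ^ 2 + 2 * m * T * gL z) μ :=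
      (hI_gg.const_mul T).add (hI_g.const_mul _)
    have hI5 : Integrable (fun z : PhaseSpace (n + 1) => 2 * m * T * gL z) μ := hI_g.const_mul _
    have hA : Integrable (fun z : PhaseSpace (n + 1) =>
        (z.2 0 ^ 2 * gL z ^ 2 + 2 * m * (z.2 0 ^ 2 * gL z)) + m ^ 2 * z.2 0 ^ 2) μ := hI1.add hI2
    have hB : Integrable (fun z : PhaseSpace (n + 1) => (T * gL z ^ 2 + 2 * m * T * gL z) + m ^ 2 * T) μ :=
      hI4.add (integrable_const _)
    rw [e1, integral_sub hA hB, integral_add hI1 hI2, integral_add hI_ppgg hI3,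
      integral_add hI4 (integrable_const _), integral_add (hI_gg.const_mul T) hI5, integral_const_mul, integral_const_mul,
      integral_const_mul, integral_const_mul, integral_const, probReal_univ, one_smul, hodd_ppg, hodd_g, hp2]
    ring
  refine ⟨?_, ?_⟩
  · rw [eK, ec, h4]; ring
  · rw [eP, ec, h4]; ring

/-- **Phonon positivity of the bath kernel, PROVED at the harmonic corner**: `K_N(t) = 2c_N(t)² ≥ 0` for `lam = β = 0` — the floors (BKᶠ), (CFᶠ) hold there
with constant `A = 0`. [this cell] -/
theorem bathKinCorr_harmonic_nonneg {ω₂ γ T : ℝ} (hω : 0 < ω₂) (hγ : 0 ≤ γ) (hT : 0 < T) {N : ℕ} (hN : 0 < N) (t : ℝ) :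
    0 ≤ bathKinCorr ω₂ 0 0 γ T N t := by
  rw [(bathKinCorr_commonPast_harmonic_eq hω hγ hT hN t).1]; positivity

/-- **Classical FDT at the bath site, PROVED** (harmonic corner): `c_N(t) = T·G₀₀(t)`, `G₀₀(t) := (Φ_t(e_{p₀}, 0))_{p₀}` the deterministic impulse response of
the boundary momentum to a unit kick on itself (constructed flow from `(0, e₀)` with zero noise); hence `K_N = 2T²G₀₀²` for phonons — the «square of a
linear functional» made explicit. [cite: RiederLebowitzLieb1967] -/
theorem bathMomCorr_harmonic_eq_response {ω₂ γ T : ℝ} (hω : 0 < ω₂) (hγ : 0 ≤ γ) (hT : 0 < T) (n : ℕ) (t : ℝ) :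
    bathMomCorr ω₂ 0 0 γ T (n + 1) t =
      T * ((pinnedChain ω₂ 0 0 γ).chainFlow (n + 1) ((0, Pi.single 0 1) : PhaseSpace (n + 1)) 0 ((t.toNNReal : ℝ≥0) : ℝ)).2 0 := by
  have hn : 0 < n + 1 := Nat.succ_pos n
  set P := pinnedChain ω₂ 0 0 γ with hP
  set τ : ℝ≥0 := t.toNNReal with hτ
  set μ := P.gibbsMeasure (n + 1) T with hμ
  haveI : IsProbabilityMeasure μ := pinnedChain_isProbabilityMeasure_gibbsMeasure hω le_rfl le_rfl γ (n + 1) hT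
  obtain ⟨M, hM⟩ := harmonic_chainFlow_zero_noise_linear hω hγ (n + 1) (τ : ℝ)
  set gL : PhaseSpace (n + 1) →L[ℝ] ℝ :=
    LinearMap.toContinuousLinearMap (((LinearMap.proj (0 : Fin (n + 1))).comp (LinearMap.snd ℝ _ _)).comp M) with hgL
  have hg : ∀ x, gL x = (M x).2 0 := fun x => rfl
  set G := ‖gL‖ with hG
  have hgb : ∀ x, |gL x| ≤ G * ‖x‖ := fun x => by
    have := gL.le_opNorm x; rwa [Real.norm_eq_abs] at this
  set m : ℝ := ∫ y, y.2 (0 : Fin (n + 1)) ∂(P.transitionKernel (n + 1) T T τ 0) with hm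
  have hK1 : ∀ z : PhaseSpace (n + 1), ∫ y, y.2 0 ∂(P.transitionKernel (n + 1) T T τ z) = gL z + m := by
    intro z
    rw [harmonic_kernel_momentum hω hγ hn hT τ z 0, hM z, hg]
  have hgc : Continuous fun x : PhaseSpace (n + 1) => gL x := gL.continuous
  have hpc : Continuous fun x : PhaseSpace (n + 1) => x.2 (0 : Fin (n + 1)) := by fun_prop
  have hI_p : Integrable (fun x : PhaseSpace (n + 1) => x.2 0) μ := by
    refine integrable_gibbsMeasure_of_growth hω le_rfl le_rfl hT hpc (A := 1) fun x => ?_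
    have h1 := OscillatorChain.abs_snd_apply_le_norm x 0
    have h2 := (pow_le_one_add_sq_sq (norm_nonneg x)).1
    linarith
  have hI_pg : Integrable (fun x : PhaseSpace (n + 1) => x.2 0 * gL x) μ := by
    refine integrable_gibbsMeasure_of_growth hω le_rfl le_rfl hT (hpc.mul hgc) (A := G) fun x => ?_
    have h1 := OscillatorChain.abs_snd_apply_le_norm x 0
    have h4 := (pow_le_one_add_sq_sq (norm_nonneg x)).2.1
    rw [abs_mul]
    calc |x.2 0| * |gL x| ≤ ‖x‖ * (G * ‖x‖) := mul_le_mul h1 (hgb x) (abs_nonneg _) (norm_nonneg _)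
      _ = G * ‖x‖ ^ 2 := by ring
      _ ≤ G * (1 + ‖x‖ ^ 2) ^ 2 := by nlinarith [norm_nonneg gL]
  have hodd_p : ∫ x, x.2 (0 : Fin (n + 1)) ∂μ = 0 :=
    integral_gibbsMeasure_eq_zero_of_odd (n + 1) T (fun x => by simp)
  have hstein : ∫ x, x.2 0 * gL x ∂μ = T * gL ((0, Pi.single 0 1) : PhaseSpace (n + 1)) :=
    gibbs_momentum_mul_clm hω le_rfl le_rfl hT 0 gL
  unfold bathMomCorr
  rw [dif_pos hn]
  change ∫ z, z.2 0 * (∫ y, y.2 0 ∂(P.transitionKernel (n + 1) T T τ z)) ∂μ = _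
  simp_rw [hK1]
  have : (fun z : PhaseSpace (n + 1) => z.2 0 * (gL z + m)) = fun z => z.2 0 * gL z + m * z.2 0 :=
    funext fun z => by ring
  rw [this, integral_add hI_pg (hI_p.const_mul m), integral_const_mul, hodd_p, mul_zero, add_zero, hstein, hg, ← hM]

/-- ★ **The Wick defect of the harmonic chain is EMPTY**: `κ_N(t) = 0` (`lam = β = 0`; every `N ≥ 1`, `t`). [this cell] -/
theorem bathCumulant_harmonic_eq_zero {ω₂ γ T : ℝ} (hω : 0 < ω₂) (hγ : 0 ≤ γ) (hT : 0 < T) {N : ℕ} (hN : 0 < N) (t : ℝ) :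
    bathCumulant ω₂ 0 0 γ T N t = 0 := by
  unfold bathCumulant
  rw [(bathKinCorr_commonPast_harmonic_eq hω hγ hT hN t).1]
  ring

/-- ★ **The static forecast cumulant of the harmonic chain vanishes**: `SQ_N(t) = 0` (`lam = β = 0`). With `bathVarChannel_harmonic_eq_zero`: ALL THREE
anharmonic pieces `κ_N`, `SQ_N`, `VC_N` of this file are identically zero for phonons, for every `N` and `t` — their floors hold with constant `0`. [this cell] -/
theorem bathStaticCumulant_harmonic_eq_zero {ω₂ γ T : ℝ} (hω : 0 < ω₂) (hγ : 0 ≤ γ) (hT : 0 < T) {N : ℕ} (hN : 0 < N) (t : ℝ) :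
    bathStaticCumulant ω₂ 0 0 γ T N t = 0 := by
  unfold bathStaticCumulant
  rw [(bathKinCorr_commonPast_harmonic_eq hω hγ hT hN t).2]
  ring

/-- ★ **(SQᶠ_{p,α}) ∧ (VCᶠ_{p,α}) ⟹ (CFᶠ_{p,α})** (constants add; `N₀ ≥ 1`). [this cell] -/
theorem bathCumulantFloor_of_staticCumulantFloor_varChannelFloor {p α : ℝ} (hS : BathStaticCumulantFloor p α)
    (hV : BathVarChannelFloor p α) : BathCumulantFloor p α := by
  intro ω₂ lam β γ hω hl hβ hγ T hT
  obtain ⟨A, t₀, ht₀, N₀, hA⟩ := hS ω₂ lam β γ hω hl hβ hγ T hT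
  obtain ⟨A', t₀', ht₀', N₀', hA'⟩ := hV ω₂ lam β γ hω hl hβ hγ T hT
  refine ⟨A + A', max t₀ t₀', lt_max_of_lt_left ht₀, max (max N₀ N₀') 1, fun N hN r hr => ?_⟩
  have hN1 : 0 < N := lt_of_lt_of_le Nat.one_pos (le_trans (le_max_right _ _) hN)
  have h1 := hA N (le_trans (le_trans (le_max_left _ _) (le_max_left _ _)) hN) r (le_trans (le_max_left _ _) hr)
  have h2 := hA' N (le_trans (le_trans (le_max_right _ _) (le_max_left _ _)) hN) r (le_trans (le_max_right _ _) hr)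
  rw [bathCumulant_eq_staticCumulant_add_varChannel hω hl hβ hγ hT hN1 r]
  nlinarith

/-- ★★ **(S) ∧ (SQᶠ_{0,3/2}) ∧ (VCᶠ_{0,3/2}) ⟹ 11071** — the two-channel door beneath the blocker. [this cell] -/
theorem boundedResponse_of_subdiffusiveBondHeat_channelFloors (hS : SubdiffusiveBondHeat) (hQ : BathStaticCumulantFloor 0 (3 / 2))
    (hV : BathVarChannelFloor 0 (3 / 2)) : BoundedResponse :=
  boundedResponse_of_subdiffusiveBondHeat_bathCumulantFloor hS (bathCumulantFloor_of_staticCumulantFloor_varChannelFloor hQ hV)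

/-- ★ **(CPᶠ_{p,α}) ∧ (VCᶠ_{p,α}) ⟹ (BKᶠ_{p,α})** — the two channels of `K_N = CP_N + VC_N` floor the kernel directly (no Wick subtraction needed for
the blocker; constants add; `N₀ ≥ 1`). [this cell] -/
theorem bathKernelFloor_of_commonPastFloor_varChannelFloor {p α : ℝ} (hP : BathCommonPastFloor p α) (hV : BathVarChannelFloor p α) :
    BathKernelFloor p α := by
  intro ω₂ lam β γ hω hl hβ hγ T hT
  obtain ⟨A, t₀, ht₀, N₀, hA⟩ := hP ω₂ lam β γ hω hl hβ hγ T hT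
  obtain ⟨A', t₀', ht₀', N₀', hA'⟩ := hV ω₂ lam β γ hω hl hβ hγ T hT
  refine ⟨A + A', max t₀ t₀', lt_max_of_lt_left ht₀, max (max N₀ N₀') 1, fun N hN r hr => ?_⟩
  have hN1 : 0 < N := lt_of_lt_of_le Nat.one_pos (le_trans (le_max_right _ _) hN)
  have h1 := hA N (le_trans (le_trans (le_max_left _ _) (le_max_left _ _)) hN) r (le_trans (le_max_left _ _) hr)
  have h2 := hA' N (le_trans (le_trans (le_max_right _ _) (le_max_left _ _)) hN) r (le_trans (le_max_right _ _) hr)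
  rw [bathKinCorr_eq_commonPast_add_varChannel hω hl hβ hγ hT hN1 r]
  nlinarith

/-- ★★ **(S) ∧ (CPᶠ_{0,3/2}) ∧ (VCᶠ_{0,3/2}) ⟹ 11071** — the weakest two-channel door beneath the blocker typed in this file. [this cell] -/
theorem boundedResponse_of_subdiffusiveBondHeat_commonPast_varChannel (hS : SubdiffusiveBondHeat) (hP : BathCommonPastFloor 0 (3 / 2))
    (hV : BathVarChannelFloor 0 (3 / 2)) : BoundedResponse :=
  boundedResponse_of_subdiffusiveBondHeat_bathKernelFloor hS (bathKernelFloor_of_commonPastFloor_varChannelFloor hP hV)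

/-- **Phonon positivity of the common-past channel, PROVED at the harmonic corner**: `CP_N(t) = 2c_N(t)² ≥ 0` (`lam = β = 0`). [this cell] -/
theorem bathCommonPast_harmonic_nonneg {ω₂ γ T : ℝ} (hω : 0 < ω₂) (hγ : 0 ≤ γ) (hT : 0 < T) {N : ℕ} (hN : 0 < N) (t : ℝ) :
    0 ≤ bathCommonPast ω₂ 0 0 γ T N t := by
  rw [(bathKinCorr_commonPast_harmonic_eq hω hγ hT hN t).2]; positivity

end Summit.AtomisticToContinuum.FouriersLaw.Theorems.BoundedResponse.HeatSpreading
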